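import Summits.RiemannHypothesis.RiemannHypothesis.Theorems.NymanBeurlingKappaKernel
import Summits.RiemannHypothesis.RiemannHypothesis.Theorems.NymanBeurlingFareyMean
import HarnessLib

/-!
# RiemannHypothesis / Nyman–Beurling — `κ_∞` in the kernel, II: soundness of the pass and the Boolean test (`K = 999`)

Part II of the `κ_∞` certificate (see `NymanBeurlingKappaKernel.lean`): the product enclosures `xl_le`/`le_xh`, the invariant
`run_sound` (the state after `run k` encloses `Σ_{m≤k+1}Λ(m)/m`, `Σ_{m≤k+1}Λ(m)`, `m_{k+1}` and
`X_{k+1} = Σ_{j=2}^{k+1}(m_j − m_{j−1})·nbDilatePrimeSide j`), the rational constants of the final comparison and the test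
`kappaCheck` (indices `2..1000`) with `kappaCheck_eq : kappaCheck = true` by `decide +kernel`.
RH-FREE [rh-li-eng-3 g5]: certified numerics; nothing here bears on the truth of RH.
-/

noncomputable section

set_option linter.dupNamespace false

open Filter Set Finset
open scoped Real

namespace Summit.RiemannHypothesis.RiemannHypothesis.Theorems.NbTheory

open Literature.NumberTheory.LFunctions Literature.Analysis.SpecialFunctions.KernelLog

open KappaCert

namespace KappaCert

/-- `A(n) = Σ_{m≤n} Λ(m)/m`. (local abbreviation inside statements only) -/
lemma sum_range_succ_vonMangoldt_div (n : ℕ) :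
    ∑ m ∈ Finset.range (n + 2), (ArithmeticFunction.vonMangoldt m : ℝ) / m =
      ∑ m ∈ Finset.range (n + 1), (ArithmeticFunction.vonMangoldt m : ℝ) / m +
        (ArithmeticFunction.vonMangoldt (n + 1) : ℝ) / ((n : ℝ) + 1) := by
  rw [Finset.sum_range_succ]; push_cast; ring

/-- Lower product bound: with `0 ≤ wl/S ≤ w ≤ wh/S`, `pl/S ≤ P ≤ ph/S`, the `step` lower summand encloses `w·P` from below. -/
lemma xl_le {w P : ℝ} {wl wh pl : ℤ} (hwl0 : 0 ≤ wl) (hwl : (wl : ℝ) / 2 ^ 80 ≤ w)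
    (hwh : w ≤ (wh : ℝ) / 2 ^ 80) (hpl : (pl : ℝ) / 2 ^ 80 ≤ P) :
    (((if 0 ≤ pl then wl * pl / LOGSC else wh * pl / LOGSC : ℤ)) : ℝ) / 2 ^ 80 ≤ w * P := by
  have hS : (0 : ℝ) < (2 : ℝ) ^ 80 := by positivity
  have hSZ : (0 : ℤ) < LOGSC := by norm_num [LOGSC]
  have hw0 : 0 ≤ w := le_trans (by positivity) hwl
  split_ifs with hp
  · have hf := floor_le (t := wl * pl) hSZ
    rw [QDigits.cast_LOGSC] at hf; push_cast at hf
    have hP0 : 0 ≤ P := le_trans (by positivity) hpl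
    have hplR : (0 : ℝ) ≤ pl := by exact_mod_cast hp
    -- `(wl/S)(pl/S) ≤ w P`
    have h1 : (wl : ℝ) / 2 ^ 80 * ((pl : ℝ) / 2 ^ 80) ≤ w * P :=
      mul_le_mul hwl hpl (by positivity) hw0
    rw [div_le_iff₀ hS]
    calc (((wl * pl / LOGSC : ℤ)) : ℝ) ≤ (wl : ℝ) * pl / 2 ^ 80 := hf
      _ = (wl : ℝ) / 2 ^ 80 * ((pl : ℝ) / 2 ^ 80) * 2 ^ 80 := by field_simp
      _ ≤ w * P * 2 ^ 80 := by nlinarith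
  · push Not at hp
    have hf := floor_le (t := wh * pl) hSZ
    rw [QDigits.cast_LOGSC] at hf; push_cast at hf
    have hplR : (pl : ℝ) < 0 := by exact_mod_cast hp
    have hwh0 : 0 ≤ (wh : ℝ) / 2 ^ 80 := le_trans hw0 hwh
    -- `(wh/S)(pl/S) ≤ w P`
    have h1 : (wh : ℝ) / 2 ^ 80 * ((pl : ℝ) / 2 ^ 80) ≤ w * P := by
      by_cases hP : 0 ≤ P
      · have : (wh : ℝ) / 2 ^ 80 * ((pl : ℝ) / 2 ^ 80) ≤ 0 :=
          mul_nonpos_of_nonneg_of_nonpos hwh0 (by apply div_nonpos_of_nonpos_of_nonneg <;> [linarith; positivity])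
        nlinarith
      · push Not at hP
        -- `w P ≥ (wh/S) P ≥ (wh/S)(pl/S)`
        have h2 : (wh : ℝ) / 2 ^ 80 * P ≤ w * P := by nlinarith
        have h3 : (wh : ℝ) / 2 ^ 80 * ((pl : ℝ) / 2 ^ 80) ≤ (wh : ℝ) / 2 ^ 80 * P :=
          mul_le_mul_of_nonneg_left hpl hwh0
        linarith
    rw [div_le_iff₀ hS]
    calc (((wh * pl / LOGSC : ℤ)) : ℝ) ≤ (wh : ℝ) * pl / 2 ^ 80 := hf
      _ = (wh : ℝ) / 2 ^ 80 * ((pl : ℝ) / 2 ^ 80) * 2 ^ 80 := by field_simp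
      _ ≤ w * P * 2 ^ 80 := by nlinarith

/-- Upper product bound (companion of `xl_le`). -/
lemma le_xh {w P : ℝ} {wl wh ph : ℤ} (hwl0 : 0 ≤ wl) (hwl : (wl : ℝ) / 2 ^ 80 ≤ w)
    (hwh : w ≤ (wh : ℝ) / 2 ^ 80) (hph : P ≤ (ph : ℝ) / 2 ^ 80) :
    w * P ≤ (((if 0 ≤ ph then -((-(wh * ph)) / LOGSC) else -((-(wl * ph)) / LOGSC) : ℤ)) : ℝ) / 2 ^ 80 := by
  have hS : (0 : ℝ) < (2 : ℝ) ^ 80 := by positivity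
  have hSZ : (0 : ℤ) < LOGSC := by norm_num [LOGSC]
  have hw0 : 0 ≤ w := le_trans (by positivity) hwl
  have hwh0 : 0 ≤ (wh : ℝ) / 2 ^ 80 := le_trans hw0 hwh
  split_ifs with hp
  · have hc := le_ceil (t := wh * ph) hSZ
    rw [QDigits.cast_LOGSC] at hc; push_cast at hc
    have hphR : (0 : ℝ) ≤ ph := by exact_mod_cast hp
    have h1 : w * P ≤ (wh : ℝ) / 2 ^ 80 * ((ph : ℝ) / 2 ^ 80) := by
      by_cases hP : 0 ≤ P
      · exact mul_le_mul hwh hph hP hwh0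
      · push Not at hP
        have : w * P ≤ 0 := mul_nonpos_of_nonneg_of_nonpos hw0 hP.le
        have : 0 ≤ (wh : ℝ) / 2 ^ 80 * ((ph : ℝ) / 2 ^ 80) := by positivity
        linarith
    rw [le_div_iff₀ hS]
    push_cast
    calc w * P * 2 ^ 80 ≤ (wh : ℝ) / 2 ^ 80 * ((ph : ℝ) / 2 ^ 80) * 2 ^ 80 := by nlinarith
      _ = (wh : ℝ) * ph / 2 ^ 80 := by field_simp
      _ ≤ _ := hc
  · push Not at hp
    have hc := le_ceil (t := wl * ph) hSZ
    rw [QDigits.cast_LOGSC] at hc; push_cast at hc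
    have hphR : (ph : ℝ) < 0 := by exact_mod_cast hp
    have hP : P < 0 := lt_of_le_of_lt hph (by apply div_neg_of_neg_of_pos <;> [exact hphR; positivity])
    -- `w P ≤ (wl/S) P ≤ (wl/S)(ph/S)`
    have h2 : w * P ≤ (wl : ℝ) / 2 ^ 80 * P := by nlinarith
    have h3 : (wl : ℝ) / 2 ^ 80 * P ≤ (wl : ℝ) / 2 ^ 80 * ((ph : ℝ) / 2 ^ 80) :=
      mul_le_mul_of_nonneg_left hph (by positivity)
    rw [le_div_iff₀ hS]
    push_cast
    calc w * P * 2 ^ 80 ≤ (wl : ℝ) / 2 ^ 80 * ((ph : ℝ) / 2 ^ 80) * 2 ^ 80 := by nlinarith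
      _ = (wl : ℝ) * ph / 2 ^ 80 := by field_simp
      _ ≤ _ := hc

/-- **Soundness of the pass**: `run k = some s` encloses `A(k+1)`, `Ψ(k+1)`, `m_{k+1}` and
`X_{k+1} = Σ_{j=2}^{k+1} (m_j − m_{j−1})·nbDilatePrimeSide j`. -/
theorem run_sound : ∀ (k : ℕ) {Alo Ahi Plo Phi mlo mhi Xlo Xhi : ℤ},
    run k = some (Alo, Ahi, Plo, Phi, mlo, mhi, Xlo, Xhi) →
      ((Alo : ℝ) / 2 ^ 80 ≤ ∑ m ∈ Finset.range (k + 2), (ArithmeticFunction.vonMangoldt m : ℝ) / m ∧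
        ∑ m ∈ Finset.range (k + 2), (ArithmeticFunction.vonMangoldt m : ℝ) / m ≤ (Ahi : ℝ) / 2 ^ 80) ∧
      ((Plo : ℝ) / 2 ^ 80 ≤ ∑ m ∈ Finset.range (k + 2), (ArithmeticFunction.vonMangoldt m : ℝ) ∧
        ∑ m ∈ Finset.range (k + 2), (ArithmeticFunction.vonMangoldt m : ℝ) ≤ (Phi : ℝ) / 2 ^ 80) ∧
      ((mlo : ℝ) / 2 ^ 80 ≤ nbFareyMean (k + 1) ∧ nbFareyMean (k + 1) ≤ (mhi : ℝ) / 2 ^ 80) ∧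
      ((Xlo : ℝ) / 2 ^ 80 ≤ ∑ j ∈ Finset.Ico 2 (k + 2),
          (nbFareyMean j - nbFareyMean (j - 1)) * nbDilatePrimeSide j ∧
        ∑ j ∈ Finset.Ico 2 (k + 2), (nbFareyMean j - nbFareyMean (j - 1)) * nbDilatePrimeSide j ≤
          (Xhi : ℝ) / 2 ^ 80)
  | 0, Alo, Ahi, Plo, Phi, mlo, mhi, Xlo, Xhi, h => by
    unfold run at h
    cases hm : mIv 1 with
    | none => simp only [hm] at h; simp at h
    | some q =>
      obtain ⟨ml, mh⟩ := q
      simp only [hm, Option.some.injEq, Prod.mk.injEq] at h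
      obtain ⟨rfl, rfl, rfl, rfl, rfl, rfl, rfl, rfl⟩ := h
      have hm1 := mIv_sound le_rfl hm
      have hA : ∑ m ∈ Finset.range (0 + 2), (ArithmeticFunction.vonMangoldt m : ℝ) / m = 0 := by
        simp [Finset.sum_range_succ]
      have hP : ∑ m ∈ Finset.range (0 + 2), (ArithmeticFunction.vonMangoldt m : ℝ) = 0 := by
        simp [Finset.sum_range_succ]
      rw [hA, hP]
      simp only [Int.cast_zero, zero_div, le_refl, and_self, true_and, zero_add]
      refine ⟨hm1, ?_⟩
      simp
  | k + 1, Alo, Ahi, Plo, Phi, mlo, mhi, Xlo, Xhi, h => by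
    unfold run at h
    cases hr : run k with
    | none => simp only [hr] at h; simp at h
    | some s =>
      obtain ⟨a1, a2, p1, p2, m1, m2, x1, x2⟩ := s
      simp only [hr] at h
      obtain ⟨⟨iA1, iA2⟩, ⟨iP1, iP2⟩, ⟨im1, im2⟩, ⟨iX1, iX2⟩⟩ := run_sound k hr
      -- unfold the step
      unfold step at h
      cases hl : lamIv (k + 1 + 1) with
      | none => simp only [hl] at h; simp at h
      | some ql =>
        obtain ⟨ll, lh⟩ := ql
        cases hmm : mIv (k + 1 + 1) with
        | none => simp only [hl, hmm] at h; simp at h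
        | some qm =>
          obtain ⟨ml, mh⟩ := qm
          simp only [hl, hmm] at h
          cases hp : pIv (k + 1 + 1) (a1 + ll / ((((k + 1 : ℕ)) : ℤ) + 1)) (a2 + -(-lh / ((((k + 1 : ℕ)) : ℤ) + 1)))
              (p1 + ll) (p2 + lh) with
          | none => simp only [hp] at h; simp at h
          | some qp =>
            obtain ⟨pl, ph⟩ := qp
            simp only [hp, Option.some.injEq, Prod.mk.injEq] at h
            obtain ⟨rfl, rfl, rfl, rfl, rfl, rfl, rfl, rfl⟩ := h
            have hS : (0 : ℝ) < (2 : ℝ) ^ 80 := by positivity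
            have hkZ : (0 : ℤ) < (((k + 1 : ℕ)) : ℤ) + 1 := by positivity
            have hkR : (((((k + 1 : ℕ)) : ℤ) + 1 : ℤ) : ℝ) = (k : ℝ) + 1 + 1 := by push_cast; ring
            have hk0 : (0 : ℝ) < (k : ℝ) + 1 + 1 := by positivity
            obtain ⟨hll, hlh⟩ := lamIv_sound hl
            obtain ⟨hml, hmh⟩ := mIv_sound (by omega) hmm
            -- the new `A`, `Ψ`
            have eA : ∑ m ∈ Finset.range (k + 1 + 2), (ArithmeticFunction.vonMangoldt m : ℝ) / m =
                ∑ m ∈ Finset.range (k + 2), (ArithmeticFunction.vonMangoldt m : ℝ) / m +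
                  (ArithmeticFunction.vonMangoldt (k + 1 + 1) : ℝ) / ((k : ℝ) + 1 + 1) := by
              rw [show k + 1 + 2 = (k + 1) + 2 from rfl, sum_range_succ_vonMangoldt_div (k + 1)]
              push_cast; ring_nf
            have eP : ∑ m ∈ Finset.range (k + 1 + 2), (ArithmeticFunction.vonMangoldt m : ℝ) =
                ∑ m ∈ Finset.range (k + 2), (ArithmeticFunction.vonMangoldt m : ℝ) +
                  (ArithmeticFunction.vonMangoldt (k + 1 + 1) : ℝ) := by
              rw [show k + 1 + 2 = (k + 2) + 1 from rfl, Finset.sum_range_succ]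
            have hcast : (((k + 1 + 1 : ℕ)) : ℝ) = (k : ℝ) + 1 + 1 := by push_cast; ring
            set Λk := (ArithmeticFunction.vonMangoldt (k + 1 + 1) : ℝ) with hΛk
            have hA1' : (((a1 + ll / ((((k + 1 : ℕ)) : ℤ) + 1)) : ℤ) : ℝ) / 2 ^ 80 ≤
                ∑ m ∈ Finset.range (k + 1 + 2), (ArithmeticFunction.vonMangoldt m : ℝ) / m := by
              rw [eA]
              have hf := floor_le (t := ll) hkZ
              rw [hkR] at hf
              have : (((ll / ((((k + 1 : ℕ)) : ℤ) + 1)) : ℤ) : ℝ) / 2 ^ 80 ≤ Λk / ((k : ℝ) + 1 + 1) := by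
                rw [div_le_iff₀ hS]
                calc (((ll / ((((k + 1 : ℕ)) : ℤ) + 1)) : ℤ) : ℝ) ≤ (ll : ℝ) / ((k : ℝ) + 1 + 1) := hf
                  _ ≤ Λk * 2 ^ 80 / ((k : ℝ) + 1 + 1) := by
                    refine div_le_div_of_nonneg_right ?_ hk0.le
                    rw [div_le_iff₀ hS] at hll; exact hll
                  _ = Λk / ((k : ℝ) + 1 + 1) * 2 ^ 80 := by ring
              push_cast [Int.cast_add] at this ⊢
              rw [add_div]
              linarith
            have hA2' : ∑ m ∈ Finset.range (k + 1 + 2), (ArithmeticFunction.vonMangoldt m : ℝ) / m ≤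
                (((a2 + -(-lh / ((((k + 1 : ℕ)) : ℤ) + 1))) : ℤ) : ℝ) / 2 ^ 80 := by
              rw [eA]
              have hc := le_ceil (t := lh) hkZ
              rw [hkR] at hc
              have : Λk / ((k : ℝ) + 1 + 1) ≤ (((-(-lh / ((((k + 1 : ℕ)) : ℤ) + 1))) : ℤ) : ℝ) / 2 ^ 80 := by
                rw [le_div_iff₀ hS]
                calc Λk / ((k : ℝ) + 1 + 1) * 2 ^ 80 = Λk * 2 ^ 80 / ((k : ℝ) + 1 + 1) := by ring
                  _ ≤ (lh : ℝ) / ((k : ℝ) + 1 + 1) := by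
                    refine div_le_div_of_nonneg_right ?_ hk0.le
                    rw [le_div_iff₀ hS] at hlh; exact hlh
                  _ ≤ _ := hc
              push_cast [Int.cast_add] at this ⊢
              rw [add_div]
              linarith
            have hP1' : (((p1 + ll : ℤ)) : ℝ) / 2 ^ 80 ≤ ∑ m ∈ Finset.range (k + 1 + 2), (ArithmeticFunction.vonMangoldt m : ℝ) := by
              rw [eP]; push_cast; rw [add_div]; linarith
            have hP2' : ∑ m ∈ Finset.range (k + 1 + 2), (ArithmeticFunction.vonMangoldt m : ℝ) ≤ (((p2 + lh : ℤ)) : ℝ) / 2 ^ 80 := by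
              rw [eP]; push_cast; rw [add_div]; linarith
            obtain ⟨hpl, hph⟩ := pIv_sound (by omega : 2 ≤ k + 1 + 1) hA1' hA2' hP1' hP2' hp
            -- the weight
            set w := nbFareyMean (k + 1 + 1) - nbFareyMean (k + 1) with hw
            have hw0 : 0 ≤ w := by
              have := nbFareyMean_mono (Nat.le_succ (k + 1)); rw [hw]; linarith
            have hwl : (((max (ml - m2) 0 : ℤ)) : ℝ) / 2 ^ 80 ≤ w := by
              rcases le_total (ml - m2) 0 with hc | hc
              · rw [max_eq_right hc]; simp; exact hw0
              · rw [max_eq_left hc]; push_cast; rw [sub_div, hw]; linarith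
            have hwl0 : (0 : ℤ) ≤ max (ml - m2) 0 := le_max_right _ _
            have hwh : w ≤ (((mh - m1 : ℤ)) : ℝ) / 2 ^ 80 := by push_cast; rw [sub_div, hw]; linarith
            have hxl := xl_le (P := nbDilatePrimeSide (k + 1 + 1)) (pl := pl) hwl0 hwl hwh hpl
            have hxh := le_xh (P := nbDilatePrimeSide (k + 1 + 1)) (ph := ph) hwl0 hwl hwh hph
            -- the new `X`
            have eX : ∑ j ∈ Finset.Ico 2 (k + 1 + 2), (nbFareyMean j - nbFareyMean (j - 1)) * nbDilatePrimeSide j =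
                ∑ j ∈ Finset.Ico 2 (k + 2), (nbFareyMean j - nbFareyMean (j - 1)) * nbDilatePrimeSide j +
                  w * nbDilatePrimeSide (k + 1 + 1) := by
              rw [show k + 1 + 2 = (k + 2) + 1 from rfl, Finset.sum_Ico_succ_top (by omega)]
              rfl
            refine ⟨⟨hA1', hA2'⟩, ⟨hP1', hP2'⟩, ⟨hml, hmh⟩, ?_, ?_⟩
            · rw [eX, Int.cast_add, add_div]; linarith
            · rw [eX, Int.cast_add, add_div]; linarith

/-- Rational constants of the final test. -/
def M1LO : ℚ := 2 * 0.69314718055994530940 - 1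
/-- see `M1LO` -/
def M1HI : ℚ := 2 * 0.69314718055994530944 - 1
/-- see `M1LO`: lower bound for `β = 2 + γ − 2 log 2 − log π` -/
def BLO : ℚ := 2 + 0.5772156649015328 - 2 * 0.69314718055994530944 - 1.14472988584940017415
/-- see `BLO` -/
def BHI : ℚ := 2 + 0.5772156649015405 - 2 * 0.69314718055994530940 - 1.14472988584940017414
/-- see `M1LO`: the tail allowance `(0.0463/β_lo)·(r/3)/(1 − r²)`, `r = 1/2001` -/
def TMAX : ℚ := (0.0463 / BLO) * (((1 : ℚ) / 2001) / 3 / (1 - (1 / 2001) ^ 2))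

/-- **The kernel test** (`K = 999`, indices `2..1000`). -/
def kappaCheck : Bool :=
  match run 999 with
  | some (_, _, _, _, _, _, xl, xh) =>
    decide (xl ≤ 0) && decide (xh ≤ 0) &&
      decide ((0.3395 : ℚ) * (1 + 0.0803270405) * (2 ^ 80 * BLO) ≤ (M1LO - TMAX) * (2 ^ 80 * BLO) + xl) &&
      decide ((M1HI + TMAX) * (2 ^ 80 * BHI) + (xh : ℚ) ≤ (0.3401 : ℚ) * (1 + 0.0803270385) * (2 ^ 80 * BHI))
  | none => false

/-- The kernel test passes. -/
theorem kappaCheck_eq : kappaCheck = true := by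
  decide +kernel

end KappaCert

end Summit.RiemannHypothesis.RiemannHypothesis.Theorems.NbTheory

end
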